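import Literature.NumberTheory.Sieve.HeathBrownCubicLemma93Core
import Literature.NumberTheory.Sieve.HeathBrownCubicEmbeddingVolume
import HarnessLib

/-!
# From `E(𝐱)` to the generators: the lattice-point form of `𝓙 = ∫_𝒞 E'(𝐱)` ((9.15), (9.21))

Part of the reduction *Lemma 9.2 ⇐ Lemma 9.4* in §9 of D. R. Heath-Brown, *Primes represented by `x³ + 2y³`*,
Acta Math. 186 (2001) (this seat's route to the named fact `HeathBrown2001_lemma_3_8`). Pages 57–59: "Thus, if `S`
is counted by `E(𝐱)` then `S = (β)` for some `β` with `β̂ ∈ 𝒞'`. Moreover, if `Δ` and `S₀V^{−1/3}` are small enough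
… there is at most one such `β`. … We therefore set `E'(𝐱) = exp(itv⁻¹ log β(𝐱)) E(𝐱) = ∑_{β ∈ 𝒞', N(𝐱)<N(β)≤N(𝐱)+ΔV}
d_{(β)} χ(β) W((β); Δ, 𝐱){1 + O(Δ)}` (9.15) … `𝓙 = ∫_𝒞 E'(𝐱) dx dy dz` … (9.21)". This file turns the tuple sum
`E(𝐱)` (`HeathBrownCubicLemma93Core.Esum`) into a sum over lattice points (generators) and `𝓙` into the sum of the
per-generator integrals, exactly (no `O(Δ)` yet — the phase is kept inside `𝓙_v`), with the branch relation
`Near` of `HeathBrownCubicLemma95` in place of the fundamental domain: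

* Step 1, `sum_primeTuples_window_eq_sum_idealsLE` — from tuples to ideals (`d_S = ∑_{∏P_i = S} c_P`, `dWeight`);
* Step 2, `sum_idealsLE_window_eq_sum_lattice` — from ideals to the lattice points `v` of an enlarged cube with
  `β(v̂) > 0`, `N(v̂) > ΔV`, through `orbitIntegrand Δ V v̂` (`HeathBrownCubicEmbeddingVolume`): a bijection on the
  non-zero terms (`Finset.sum_bij_ne_zero`) by `existsUnique_near_generator` and Lemma 9.5 (as the hypothesis
  `Lemma95Bound C₀`, supplied by `exists_lemma95Bound`), with `ν₀((β)) = ν₀(β)` (`grossenChar_span`) and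
  `W((β); ·) = W(β̂; ·)` (`pairWeight_realVec_mul_units`);
* `phaseFn χ` (`e^{itv⁻¹ log β(𝐱)}`), `ElatSum` (`Ẽ`), `Jv` (`𝓙_v`), `Jint` (`𝓙`); `Esum_eq_ElatSum` (`E = Ẽ` on `𝒞`) and
  **`Jint_eq_sum_Jv`**: `𝓙 = ∑_v d_{(β_v)} 𝓙_v` (swap of a finite sum and the integral; `integrable_orbitIntegrand`).

Hypotheses: `CubeCond c₃ c₄ V a S₀`, `0 < Δ ≤ min(1/16, c₄/2)`, `C₀(1+c₄⁻¹)Δ ≤ 1/2`, and the enlargement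
`r ≥ 2C₀(1+c₄⁻¹)Δ·c₃V^{1/3}` (the enlarged cube is `(a − 2r, a − 2r + S₀ + 3r]³`).

## References

* D. R. Heath-Brown, *Primes represented by `x³ + 2y³`*, Acta Math. 186 (2001), §9 pp. 57–59, (9.15), (9.21).
  [cite: HeathBrownActa2001, §9 (9.15)]

## Mathlib / tree search

Tree: `Esum`, `InNormWindow`, `tupleCoeff`, `tupleIdeal`, `idealWeight`, `absNorm_tupleIdeal` (`HeathBrownCubicLemma93Core`), `orbitIntegrand`,
`orbitSet`, `integrable_orbitIntegrand` (`HeathBrownCubicEmbeddingVolume`), `HeathBrown2001_lemma_9_5`, `existsUnique_near_generator`,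
`pairWeight_realVec_mul_units`, `norm_le_two_mul_of_norm_sub_le` (`HeathBrownCubicLemma95`), `grossenChar_span`, `associated_idealGen_span`,
`realVec_coordElt` (`HeathBrownCubicGrossen`), `dWeight`, `latticeCube`, `realCube`, `CubeCond` (`HeathBrownCubicTypeII`), `mem_latticeCube_iff`,
`measurableSet_realCube` (`HeathBrownCubicCubeSums`), `abs_normForm_coordVec` (`HeathBrownCubicWindow`), `idealsLE` (`HeathBrownCubicSieveSetup`).
Mathlib: `Finset.sum_fiberwise_of_maps_to`, `Finset.sum_bij_ne_zero`, `integral_finsetSum`, `Integrable.bdd_mul`, `setIntegral_congr_fun`.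
-/

noncomputable section

open Polynomial NumberField Finset Complex MeasureTheory

namespace Literature.NumberTheory.Sieve.CubicSieve

open LFunctions.CubeRootTwoField CubicPrimes Literature.Analysis.Fourier

variable {X τ : ℝ} {n : ℕ} {m : Fin (n + 1) → ℕ} {q : ℕ} (hq : 1 ≤ q) (χ : MulChar (QuotMod q) ℂ)

/-! ### Step 1: from tuples to ideals (`d_S = ∑_{∏P_i = S} ∏ log N(P_i)/(m_iξ log X)`) -/

/-- The inner fibre sum is `d_S`: `∑_{P : ∏ P_i = S} tupleCoeff P = d_S`. [cite: HeathBrownActa2001, §3 p. 15] -/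
theorem sum_filter_tupleIdeal_eq_dWeight (S : Ideal (𝓞 K)) :
    ∑ P ∈ (primeTuples X τ m).filter (fun P => tupleIdeal P = S), tupleCoeff X τ m P = dWeight X τ m S := by
  classical
  rw [dWeight]
  rfl

/-- **From tuples to ideals**: for any `G`,
`∑_{P, window} c_P G(∏P_i) = ∑_{S ∈ idealsLE B, window} d_S G(S)` whenever `N(𝐱) + ΔV ≤ B`.
[cite: HeathBrownActa2001, §9 p. 54] -/
theorem sum_primeTuples_window_eq_sum_idealsLE (G : Ideal (𝓞 K) → ℂ) {Δ V : ℝ} {x : ℝ × ℝ × ℝ}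
    {B : ℕ} (hB : normForm x + Δ * V ≤ B) :
    ∑ P ∈ primeTuples X τ m, (if InNormWindow Δ V x P then (tupleCoeff X τ m P : ℂ) * G (tupleIdeal P) else 0) =
      ∑ S ∈ idealsLE B, (if normForm x < (Ideal.absNorm S : ℝ) ∧ (Ideal.absNorm S : ℝ) ≤ normForm x + Δ * V then
        (dWeight X τ m S : ℂ) * G S else 0) := by
  classical
  rw [← Finset.sum_filter]
  have hmaps : ∀ P ∈ (primeTuples X τ m).filter (fun P => InNormWindow Δ V x P), tupleIdeal P ∈ idealsLE B := by
    intro P hP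
    rw [Finset.mem_filter] at hP
    rw [mem_idealsLE]
    have h1 : (Ideal.absNorm (tupleIdeal P) : ℝ) ≤ B := by rw [absNorm_tupleIdeal]; exact hP.2.2.trans hB
    exact_mod_cast h1
  rw [← Finset.sum_fiberwise_of_maps_to hmaps]
  refine Finset.sum_congr rfl fun S hS => ?_
  have hfilt : ((primeTuples X τ m).filter (fun P => InNormWindow Δ V x P)).filter (fun P => tupleIdeal P = S) =
      ((primeTuples X τ m).filter (fun P => tupleIdeal P = S)).filter
        (fun _ => normForm x < (Ideal.absNorm S : ℝ) ∧ (Ideal.absNorm S : ℝ) ≤ normForm x + Δ * V) := by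
    ext P
    simp only [Finset.mem_filter, InNormWindow]
    constructor
    · rintro ⟨⟨hP, hw⟩, hPS⟩
      refine ⟨⟨hP, hPS⟩, ?_⟩
      rw [← hPS, absNorm_tupleIdeal]; exact hw
    · rintro ⟨⟨hP, hPS⟩, hw⟩
      refine ⟨⟨hP, ?_⟩, hPS⟩
      rw [← absNorm_tupleIdeal, hPS]; exact hw
  rw [hfilt, Finset.sum_filter]
  by_cases hw : normForm x < (Ideal.absNorm S : ℝ) ∧ (Ideal.absNorm S : ℝ) ≤ normForm x + Δ * V
  · simp only [if_pos hw]
    rw [← sum_filter_tupleIdeal_eq_dWeight S, Complex.ofReal_sum, Finset.sum_mul]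
    refine Finset.sum_congr rfl fun P hP => ?_
    rw [(Finset.mem_filter.mp hP).2]
  · simp only [if_neg hw, Finset.sum_const_zero]

/-! ### Step 2: from ideals to lattice points (generators on the branch of `𝐱`) -/

/-- The shape of the conclusion of `HeathBrown2001_lemma_9_5` with a given constant `C₀`, as a hypothesis of
the next statements. [cite: HeathBrownActa2001, Lemma 9.5] -/
def Lemma95Bound (C₀ : ℝ) : Prop :=
  ∀ (c₄ V Δ : ℝ) (b x : ℝ × ℝ × ℝ), 0 < c₄ → 0 < V → 0 < Δ → Δ ≤ 1 / 16 → Δ ≤ c₄ / 2 →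
    0 < ell b → 0 < ell x → Near b x → pairWeight Δ b x ≠ 0 →
    normForm b - Δ * V ≤ normForm x ∧ normForm x < normForm b → c₄ * V ≤ normForm x →
      ‖x - b‖ ≤ C₀ * (1 + 1 / c₄) * Δ * ‖b‖

/-- Lemma 9.5 supplies such a constant. [cite: HeathBrownActa2001, Lemma 9.5] -/
theorem exists_lemma95Bound : ∃ C₀ : ℝ, 0 < C₀ ∧ Lemma95Bound C₀ := HeathBrown2001_lemma_9_5

/-- `N((β_v)) = |N(v̂)|`. [folklore] -/
theorem absNorm_span_coordElt_eq_abs (v : ℤ × ℤ × ℤ) :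
    (Ideal.absNorm (Ideal.span {coordElt v}) : ℝ) = |normForm (castVec v)| := by
  have h := abs_normForm_coordVec (coordElt v)
  rw [coordVec_coordElt] at h
  exact h.symm

/-- On a vector with `β(b) > 0`, `N(b) ≥ 0`. [folklore] -/
theorem normForm_nonneg_of_ell_pos {b : ℝ × ℝ × ℝ} (hb : 0 < ell b) : 0 ≤ normForm b := by
  rw [← ell_mul_quadQ]; exact mul_nonneg hb.le (quadQ_nonneg b)

/-- If `N(b) > 0` then `β(b) > 0` (`N = β · quadQ`, `quadQ ≥ 0`). [folklore] -/
theorem ell_pos_of_normForm_pos {b : ℝ × ℝ × ℝ} (hb : 0 < normForm b) : 0 < ell b := by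
  rw [← ell_mul_quadQ] at hb
  have hq := quadQ_nonneg b
  rcases lt_trichotomy (ell b) 0 with h | h | h
  · nlinarith
  · rw [h, zero_mul] at hb; exact absurd hb (lt_irrefl 0)
  · exact h

/-- The sup norm of a point of the cube of Lemma 3.8 is `≤ c₃V^{1/3}`. [folklore] -/
theorem norm_le_of_mem_realCube {c₃ c₄ V : ℝ} {a : ℝ × ℝ × ℝ} {S₀ : ℝ} (hcube : CubeCond c₃ c₄ V a S₀)
    {x : ℝ × ℝ × ℝ} (hx : x ∈ realCube a S₀) : ‖x‖ ≤ c₃ * V ^ (1 / 3 : ℝ) := by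
  obtain ⟨h1, h2, h3, -⟩ := hcube x hx
  rw [Prod.norm_def, Prod.norm_def, Real.norm_eq_abs, Real.norm_eq_abs, Real.norm_eq_abs]
  exact max_le h1 (max_le h2 h3)

/-- A point within `r` (sup norm) of a point of the cube `(a, a+S₀]³` lies in the cube `(a − r, a − r + (S₀ + 2r)]³`
(take `a − r` strictly below). [folklore] -/
theorem mem_realCube_thicken {a : ℝ × ℝ × ℝ} {S₀ r : ℝ} {x b : ℝ × ℝ × ℝ} (hx : x ∈ realCube a S₀) (hb : ‖x - b‖ ≤ r) :
    b ∈ realCube (a.1 - 2 * r, a.2.1 - 2 * r, a.2.2 - 2 * r) (S₀ + 3 * r) := by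
  rw [mem_realCube] at hx ⊢
  rw [Prod.norm_def, Prod.norm_def, Real.norm_eq_abs, Real.norm_eq_abs, Real.norm_eq_abs] at hb
  simp only [Prod.fst_sub, Prod.snd_sub] at hb
  have h1 := (le_max_left _ _).trans hb
  have h2 := ((le_max_left _ _).trans (le_max_right _ _)).trans hb
  have h3 := ((le_max_right _ _).trans (le_max_right _ _)).trans hb
  rw [abs_le] at h1 h2 h3
  obtain ⟨⟨a1, b1⟩, ⟨a2, b2⟩, ⟨a3, b3⟩⟩ := hx
  have hr : 0 ≤ r := (abs_nonneg _).trans ((le_max_left _ _).trans hb)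
  refine ⟨⟨by linarith, by linarith⟩, ⟨by linarith, by linarith⟩, ⟨by linarith, by linarith⟩⟩

/-- **From ideals to lattice points** ((9.15): "if `S` is counted by `E(𝐱)` then `S = (β)` for some `β` with
`β̂ ∈ 𝒞'`. Moreover … there is at most one such `β`"): for `𝐱 ∈ 𝒞`, the window sum of
`d_S ν₀(S) W(S; Δ, 𝐱)` over the ideals equals the sum over the lattice points `v` of an enlarged cube `𝒞'`
with `β(v̂) > 0` of `d_{(β_v)} ν₀(β_v) · 𝟙_{D(v̂)}(𝐱) W(v̂; Δ, 𝐱)` (`orbitIntegrand`): each `S` with a non-zero term has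
exactly one generator `β > 0` on the branch of `𝐱` (`existsUnique_near_generator`), which by Lemma 9.5 lies within
`2C₀(1+c₄⁻¹)Δ · c₃V^{1/3} ≤ r` of `𝐱`. [cite: HeathBrownActa2001, §9 (9.15)] -/
theorem sum_idealsLE_window_eq_sum_lattice {C₀ : ℝ} (h95 : Lemma95Bound C₀) (hC₀ : 0 < C₀)
    {c₃ c₄ V Δ : ℝ} (hc₄ : 0 < c₄) (hV : 0 < V) (hΔ : 0 < Δ) (hΔ16 : Δ ≤ 1 / 16) (hΔc : Δ ≤ c₄ / 2)
    (hκ : C₀ * (1 + 1 / c₄) * Δ ≤ 1 / 2) {a : ℝ × ℝ × ℝ} {S₀ : ℝ} (hcube : CubeCond c₃ c₄ V a S₀)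
    {r : ℝ} (hr : 2 * (C₀ * (1 + 1 / c₄) * Δ) * (c₃ * V ^ (1 / 3 : ℝ)) ≤ r)
    {x : ℝ × ℝ × ℝ} (hx : x ∈ realCube a S₀) {B : ℕ} (hB : normForm x + Δ * V ≤ B) :
    ∑ S ∈ idealsLE B, (if normForm x < (Ideal.absNorm S : ℝ) ∧ (Ideal.absNorm S : ℝ) ≤ normForm x + Δ * V then
        (dWeight X τ m S : ℂ) * (grossenChar hq χ 0 0 S * (idealWeight Δ S x : ℂ)) else 0) =
      ∑ v ∈ (latticeCube (a.1 - 2 * r, a.2.1 - 2 * r, a.2.2 - 2 * r) (S₀ + 3 * r)).filter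
          (fun v => 0 < ell (castVec v) ∧ Δ * V < normForm (castVec v)),
        (dWeight X τ m (Ideal.span {coordElt v}) : ℂ) * nu0O χ (coordElt v) * (orbitIntegrand Δ V (castVec v) x : ℂ) := by
  classical
  have hNx : c₄ * V ≤ normForm x := by have := (hcube x hx).2.2.2; rw [normForm]; exact this
  have hNx0 : 0 < normForm x := lt_of_lt_of_le (by positivity) hNx
  have hellx : 0 < ell x := ell_pos_of_normForm_pos hNx0
  symm
  refine Finset.sum_bij_ne_zero (fun v _ _ => Ideal.span {coordElt v}) ?_ ?_ ?_ ?_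
  · -- membership
    intro v hv hne
    rw [Finset.mem_filter] at hv
    rw [mem_idealsLE]
    have hwin : normForm (castVec v) - Δ * V ≤ normForm x ∧ normForm x < normForm (castVec v) := by
      by_contra h
      apply hne
      rw [orbitIntegrand, Set.indicator_of_notMem (fun h' => h ⟨h'.2.2.1, h'.2.2.2⟩), Complex.ofReal_zero, mul_zero]
    have h1 : (Ideal.absNorm (Ideal.span {coordElt v}) : ℝ) ≤ B := by
      rw [absNorm_span_coordElt_eq_abs, abs_of_nonneg (normForm_nonneg_of_ell_pos hv.2.1)]; linarith [hwin.1]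
    exact_mod_cast h1
  · -- injectivity
    intro v₁ hv₁ hne₁ v₂ hv₂ hne₂ heq
    rw [Finset.mem_filter] at hv₁ hv₂
    have hnear₁ : Near (castVec v₁) x := by
      by_contra h; apply hne₁
      rw [orbitIntegrand, Set.indicator_of_notMem (fun h' => h h'.2.1), Complex.ofReal_zero, mul_zero]
    have hnear₂ : Near (castVec v₂) x := by
      by_contra h; apply hne₂
      rw [orbitIntegrand, Set.indicator_of_notMem (fun h' => h h'.2.1), Complex.ofReal_zero, mul_zero]
    have hβ₁ : coordElt v₁ ≠ 0 := fun h => by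
      have := hv₁.2.1; rw [← realVec_coordElt, h] at this; simp [realVec, castVec, ell] at this
    have hS : Ideal.span {coordElt v₁} ≠ ⊥ := by rwa [Ne, Ideal.span_singleton_eq_bot]
    obtain ⟨β, -, huniq⟩ := existsUnique_near_generator hS x
    have e₁ := huniq (coordElt v₁) ⟨rfl, by rw [← ell_realVec, realVec_coordElt]; exact hv₁.2.1, by rw [realVec_coordElt]; exact hnear₁⟩
    have e₂ := huniq (coordElt v₂) ⟨heq.symm, by rw [← ell_realVec, realVec_coordElt]; exact hv₂.2.1, by rw [realVec_coordElt]; exact hnear₂⟩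
    exact coordElt_injective (e₁.trans e₂.symm)
  · -- surjectivity onto the non-zero terms
    intro S hS hne
    have hw : normForm x < (Ideal.absNorm S : ℝ) ∧ (Ideal.absNorm S : ℝ) ≤ normForm x + Δ * V := by
      by_contra h; exact hne (by rw [if_neg h])
    rw [if_pos hw] at hne
    have hS0 : S ≠ ⊥ := by
      intro h; rw [h, Ideal.absNorm_bot, Nat.cast_zero] at hw; linarith [hw.1]
    obtain ⟨β, ⟨hβS, hβpos, hβnear⟩, -⟩ := existsUnique_near_generator hS0 x
    have hβ0 : β ≠ 0 := fun h => by rw [h, Ideal.span_singleton_eq_bot.mpr rfl] at hβS; exact hS0 hβS.symm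
    -- the weight through `β`
    have hWβ : idealWeight Δ S x = pairWeight Δ (realVec β) x := by
      rw [idealWeight, ← hβS]
      obtain ⟨u, hu⟩ := associated_idealGen_span β
      rw [← pairWeight_realVec_mul_units (idealGen_ne_zero (by rwa [hβS])) u x, hu]
    have hWne : pairWeight Δ (realVec β) x ≠ 0 := by
      intro h; apply hne
      rw [hWβ, h, Complex.ofReal_zero, mul_zero, mul_zero]
    have hNβ : (Ideal.absNorm S : ℝ) = normForm (realVec β) := by
      rw [← hβS, realVec]
      have h := abs_normForm_coordVec β
      rw [← h, abs_of_nonneg]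
      rw [← ell_mul_quadQ]; exact mul_nonneg hβpos.le (quadQ_nonneg _)
    have hwinβ : normForm (realVec β) - Δ * V ≤ normForm x ∧ normForm x < normForm (realVec β) := by
      rw [← hNβ]; exact ⟨by linarith [hw.2], hw.1⟩
    -- Lemma 9.5: `β̂` is close to `x`
    have h95x := h95 c₄ V Δ (realVec β) x hc₄ hV hΔ hΔ16 hΔc hβpos hellx hβnear hWne hwinβ hNx
    obtain ⟨-, hclose⟩ := norm_le_two_mul_of_norm_sub_le h95x (by positivity) hκ
    have hxn := norm_le_of_mem_realCube hcube hx
    have hdist : ‖x - realVec β‖ ≤ r := hclose.trans ((mul_le_mul_of_nonneg_left hxn (by positivity)).trans hr)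
    refine ⟨coordVec β, ?_, ?_, ?_⟩
    · rw [Finset.mem_filter, mem_latticeCube_iff]
      refine ⟨?_, ?_, ?_⟩
      · have := mem_realCube_thicken hx hdist
        rwa [realVec] at this
      · have : ell (castVec (coordVec β)) = ellO β := rfl
        rw [this]; exact hβpos
      · have : normForm (castVec (coordVec β)) = normForm (realVec β) := rfl
        rw [this]
        have hΔV : Δ * V < c₄ * V := by nlinarith
        linarith [hwinβ.2]
    · rw [coordElt_coordVec]
      change (dWeight X τ m (Ideal.span {β}) : ℂ) * nu0O χ β * (orbitIntegrand Δ V (realVec β) x : ℂ) ≠ 0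
      rw [hβS, orbitIntegrand, Set.indicator_of_mem (show x ∈ orbitSet Δ V (realVec β) from ⟨hellx, hβnear, hwinβ⟩)]
      rw [hWβ, ← hβS, grossenChar_span hq χ 0 0 hβ0, zpow_zero, zpow_zero, mul_one, mul_one, hβS] at hne
      rwa [mul_assoc]
    · rw [coordElt_coordVec, hβS]
  · -- values agree
    intro v hv hne
    rw [Finset.mem_filter] at hv
    have hmem : x ∈ orbitSet Δ V (castVec v) := by
      by_contra h; apply hne
      rw [orbitIntegrand, Set.indicator_of_notMem h, Complex.ofReal_zero, mul_zero]
    obtain ⟨-, hnear, hwin⟩ := hmem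
    have hβ0 : coordElt v ≠ 0 := fun h => by
      have := hv.2.1; rw [← realVec_coordElt, h] at this; simp [realVec, castVec, ell] at this
    have hNv : (Ideal.absNorm (Ideal.span {coordElt v}) : ℝ) = normForm (castVec v) := by
      rw [absNorm_span_coordElt_eq_abs, abs_of_nonneg (normForm_nonneg_of_ell_pos hv.2.1)]
    have hw : normForm x < (Ideal.absNorm (Ideal.span {coordElt v}) : ℝ) ∧
        (Ideal.absNorm (Ideal.span {coordElt v}) : ℝ) ≤ normForm x + Δ * V := by
      rw [hNv]; exact ⟨hwin.2, by linarith [hwin.1]⟩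
    rw [if_pos hw, grossenChar_span hq χ 0 0 hβ0, zpow_zero, zpow_zero, mul_one, mul_one, idealWeight,
      orbitIntegrand, Set.indicator_of_mem (show x ∈ orbitSet Δ V (castVec v) from ⟨‹_›, hnear, hwin⟩)]
    obtain ⟨u, hu⟩ := associated_idealGen_span (coordElt v)
    rw [← pairWeight_realVec_mul_units (idealGen_ne_zero (by rwa [Ne, Ideal.span_singleton_eq_bot])) u x, hu, realVec_coordElt]
    ring

/-! ### Step 3: `E(𝐱)` over the lattice points and `𝓙 = ∑_v d_{(β_v)} 𝓙_v` -/

section J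

variable (X τ m)

/-- **The phase `e^{itv⁻¹ log β(𝐱)}`** of `E'(𝐱) = exp(itv⁻¹ log β(𝐱)) E(𝐱)` ((9.15)), `t = t(χ)`. [cite: HeathBrownActa2001, §9 (9.15)] -/
def phaseFn (x : ℝ × ℝ × ℝ) : ℂ := Complex.exp (((charAngle χ) * (Real.log (ell x) / unitLog) : ℝ) * Complex.I)

/-- **The lattice-point form of `E(𝐱)`**: `Ẽ(𝐱) = ∑_{v ∈ 𝒞', β(v̂) > 0} d_{(β_v)} ν₀(β_v) 𝟙_{D(v̂)}(𝐱) W(v̂; Δ, 𝐱)`.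
[cite: HeathBrownActa2001, §9 (9.15)] -/
def ElatSum (Δ V : ℝ) (aP : ℝ × ℝ × ℝ) (SP : ℝ) (x : ℝ × ℝ × ℝ) : ℂ :=
  ∑ v ∈ (latticeCube aP SP).filter (fun v => 0 < ell (castVec v) ∧ Δ * V < normForm (castVec v)),
    (dWeight X τ m (Ideal.span {coordElt v}) : ℂ) * nu0O χ (coordElt v) * (orbitIntegrand Δ V (castVec v) x : ℂ)

/-- **The contribution `𝓙_v` of one generator**: `𝓙_v = ∫_𝒞 e^{itv⁻¹log β(𝐱)} ν₀(β_v) 𝟙_{D(v̂)}(𝐱) W(v̂; Δ, 𝐱) d𝐱`.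
[cite: HeathBrownActa2001, §9 (9.21)] -/
def Jv (Δ V : ℝ) (a : ℝ × ℝ × ℝ) (S₀ : ℝ) (v : ℤ × ℤ × ℤ) : ℂ :=
  ∫ x in realCube a S₀, phaseFn χ x * nu0O χ (coordElt v) * (orbitIntegrand Δ V (castVec v) x : ℂ)

/-- **`𝓙 = ∫_𝒞 e^{itv⁻¹log β(𝐱)} E(𝐱) d𝐱`** ((9.15)–(9.16)). [cite: HeathBrownActa2001, §9 (9.16)] -/
def Jint (Δ V : ℝ) (a : ℝ × ℝ × ℝ) (S₀ : ℝ) : ℂ :=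
  ∫ x in realCube a S₀, phaseFn χ x * Esum X τ m hq χ Δ V x

variable {X τ m}

/-- `|phase| = 1`. [folklore] -/
theorem norm_phaseFn (x : ℝ × ℝ × ℝ) : ‖phaseFn χ x‖ = 1 := by
  rw [phaseFn, Complex.norm_exp_ofReal_mul_I]

/-- The phase is measurable. [folklore] -/
theorem measurable_phaseFn : Measurable (phaseFn χ) := by
  unfold phaseFn
  refine Complex.measurable_exp.comp ?_
  refine (Complex.measurable_ofReal.comp ?_).mul_const _
  refine measurable_const.mul ((Real.measurable_log.comp ?_).div_const _)
  have : Continuous (ell : ℝ × ℝ × ℝ → ℝ) := by unfold ell; fun_prop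
  exact this.measurable

/-- **`E(𝐱) = Ẽ(𝐱)` on the cube** (Steps 1 and 2). [cite: HeathBrownActa2001, §9 (9.15)] -/
theorem Esum_eq_ElatSum {C₀ : ℝ} (h95 : Lemma95Bound C₀) (hC₀ : 0 < C₀)
    {c₃ c₄ V Δ : ℝ} (hc₄ : 0 < c₄) (hV : 0 < V) (hΔ : 0 < Δ) (hΔ16 : Δ ≤ 1 / 16) (hΔc : Δ ≤ c₄ / 2)
    (hκ : C₀ * (1 + 1 / c₄) * Δ ≤ 1 / 2) {a : ℝ × ℝ × ℝ} {S₀ : ℝ} (hcube : CubeCond c₃ c₄ V a S₀)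
    {r : ℝ} (hr : 2 * (C₀ * (1 + 1 / c₄) * Δ) * (c₃ * V ^ (1 / 3 : ℝ)) ≤ r)
    {x : ℝ × ℝ × ℝ} (hx : x ∈ realCube a S₀) :
    Esum X τ m hq χ Δ V x = ElatSum X τ m χ Δ V (a.1 - 2 * r, a.2.1 - 2 * r, a.2.2 - 2 * r) (S₀ + 3 * r) x := by
  rw [Esum, ElatSum]
  have h1 := sum_primeTuples_window_eq_sum_idealsLE (X := X) (τ := τ) (m := m)
    (fun S => grossenChar hq χ 0 0 S * (idealWeight Δ S x : ℂ)) (Δ := Δ) (V := V) (x := x)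
    (B := ⌈normForm x + Δ * V⌉₊) (Nat.le_ceil _)
  simp only [mul_assoc] at h1 ⊢
  rw [h1]
  have h2 := sum_idealsLE_window_eq_sum_lattice (X := X) (τ := τ) (m := m) hq χ h95 hC₀ hc₄ hV hΔ hΔ16 hΔc hκ hcube hr hx
    (B := ⌈normForm x + Δ * V⌉₊) (Nat.le_ceil _)
  simp only [mul_assoc] at h2
  exact h2

end J

section J2

variable {X τ : ℝ} {n : ℕ} {m : Fin (n + 1) → ℕ}

/-- The integrand of `𝓙_v` is integrable on the cube (`β(v̂) > 0`, `N(v̂) > ΔV`). [folklore] -/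
theorem integrableOn_Jv_integrand {Δ V : ℝ} (hΔ : 0 < Δ) (hV : 0 < V) {v : ℤ × ℤ × ℤ}
    (hv : 0 < ell (castVec v) ∧ Δ * V < normForm (castVec v)) (a : ℝ × ℝ × ℝ) (S₀ : ℝ) (c : ℂ) :
    IntegrableOn (fun x => phaseFn χ x * (c * (orbitIntegrand Δ V (castVec v) x : ℂ))) (realCube a S₀) := by
  have horb := (integrable_orbitIntegrand hΔ hV hv.1 hv.2).ofReal (𝕜 := ℂ)
  have h1 : Integrable (fun x => phaseFn χ x * (orbitIntegrand Δ V (castVec v) x : ℂ)) :=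
    horb.bdd_mul (measurable_phaseFn χ).aestronglyMeasurable (Filter.Eventually.of_forall fun x => (norm_phaseFn χ x).le)
  have h2 : (fun x => phaseFn χ x * (c * (orbitIntegrand Δ V (castVec v) x : ℂ))) =
      fun x => c * (phaseFn χ x * (orbitIntegrand Δ V (castVec v) x : ℂ)) := by funext x; ring
  rw [h2]
  exact (h1.const_mul c).integrableOn

/-- **`𝓙 = ∑_v d_{(β_v)} 𝓙_v`** ((9.15) integrated over `𝒞`, as in (9.21): "`𝓙 = ∑_{β ∈ 𝒞'} d_{(β)} χ(β){1 + O(Δ)} ∫ W((β); Δ, 𝐱) dx dy dz`",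
here before the evaluation of the `𝓙_v`). [cite: HeathBrownActa2001, §9 (9.21)] -/
theorem Jint_eq_sum_Jv {C₀ : ℝ} (h95 : Lemma95Bound C₀) (hC₀ : 0 < C₀)
    {c₃ c₄ V Δ : ℝ} (hc₄ : 0 < c₄) (hV : 0 < V) (hΔ : 0 < Δ) (hΔ16 : Δ ≤ 1 / 16) (hΔc : Δ ≤ c₄ / 2)
    (hκ : C₀ * (1 + 1 / c₄) * Δ ≤ 1 / 2) {a : ℝ × ℝ × ℝ} {S₀ : ℝ} (hcube : CubeCond c₃ c₄ V a S₀)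
    {r : ℝ} (hr : 2 * (C₀ * (1 + 1 / c₄) * Δ) * (c₃ * V ^ (1 / 3 : ℝ)) ≤ r) :
    Jint X τ m hq χ Δ V a S₀ =
      ∑ v ∈ (latticeCube (a.1 - 2 * r, a.2.1 - 2 * r, a.2.2 - 2 * r) (S₀ + 3 * r)).filter
          (fun v => 0 < ell (castVec v) ∧ Δ * V < normForm (castVec v)),
        (dWeight X τ m (Ideal.span {coordElt v}) : ℂ) * Jv χ Δ V a S₀ v := by
  rw [Jint]
  have h1 : ∫ x in realCube a S₀, phaseFn χ x * Esum X τ m hq χ Δ V x =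
      ∫ x in realCube a S₀, phaseFn χ x * ElatSum X τ m χ Δ V (a.1 - 2 * r, a.2.1 - 2 * r, a.2.2 - 2 * r) (S₀ + 3 * r) x :=
    setIntegral_congr_fun (measurableSet_realCube a S₀) fun x hx => by
      rw [Esum_eq_ElatSum hq χ h95 hC₀ hc₄ hV hΔ hΔ16 hΔc hκ hcube hr hx]
  rw [h1]
  simp only [ElatSum, Finset.mul_sum]
  rw [integral_finsetSum _ (fun v hv => integrableOn_Jv_integrand χ hΔ hV (Finset.mem_filter.mp hv).2 a S₀ _)]
  refine Finset.sum_congr rfl fun v _ => ?_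
  rw [Jv, ← integral_const_mul]
  refine integral_congr_ae (Filter.Eventually.of_forall fun x => ?_)
  simp only
  ring

end J2

end Literature.NumberTheory.Sieve.CubicSieve
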